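import Summits.ResolutionOfSingularities.ResolutionOfSingularities.Theorems.PAlterationPialtFrobenius
import Literature.AlgebraicGeometry.Resolution.ResolutionGlue
import HarnessLib

/-!
# Crux `PalterationThesis` (stmt-ResolutionOfSingularities-0552), line `Sketch` rev. c2:
# PICover resolves every radicial quotient of a regular variety (the converse of the reshape)

Route `ResolutionOfSingularities/pAlteration`; helper file (`--supports stmt-0552`). The rev. c2
skeleton derives PICover over a perfect field `K` from the new residue `R1_K` (normal degree-`p`
radicial quotients `X = W/h` of REGULAR `W` are resolvable). This file records the CONVERSE, so
that the reshape loses nothing: over a perfect field `K` of characteristic `p`,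

* `hasResolution_quotient_of_picoverOver` — **PICover over `K` resolves every integral `X` of
  finite type which receives a finite, universally injective, dominant morphism `h : W → X` from
  a REGULAR integral `W`** (any degree, any exponent; `X` normal): by Frobenius domination
  (`exists_frobeniusCover_of_finite_universallyInjective`, Temkin 2013 Rem. 1.3.5(i)) some
  `N ≅ X` is a finite radicial cover OF the regular `W`, and PICover resolves `N`;
* `r1_of_picoverOver` — in particular PICover over `K` implies `R1_K` (the binder shape of the
  registered residue `stub_r1Perfect`).

With the skeleton's chain `R1_K ⟹ ExpOneQuot_K ⟹ Core_K ⟹ DegP_K ⟹ PICover_K` this makes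
`R1_K`, "resolution of quotients of regular varieties by one `p`-closed vector field", EQUIVALENT
to PICover over every perfect field (assembled in the line's composition file once all glue
stubs have landed).
-/

set_option linter.dupNamespace false

noncomputable section

open CategoryTheory AlgebraicGeometry TopologicalSpace
open Literature.AlgebraicGeometry.Resolution Literature.AlgebraicGeometry.Motives

namespace Summit.ResolutionOfSingularities.ResolutionOfSingularities.Theorems.PalterationThesis.PerfectQuotient

/-- **PICover over a perfect field resolves every normal radicial quotient of a regular
variety.** Over a perfect field `K` of characteristic `p`, assume PICover over `K` (finite
radicial covers of regular varieties are resolvable). If `X` is a normal integral separated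
`K`-scheme of finite type and `h : W → X` is finite, universally injective and dominant with `W`
integral and regular, then `X` has a resolution: Frobenius domination yields `N ≅ X` finite,
universally injective and surjective over `W`. [cite: Temkin2013, Rem. 1.3.5(i)] -/
theorem hasResolution_quotient_of_picoverOver (p : ℕ) (hp : p.Prime) (K : Type) [Field K]
    [CharP K p] [PerfectField K]
    (hPC : ∀ (Y X : Scheme.{0}) (f : Y ⟶ Spec (.of K)) (g : X ⟶ Y),
      IsSeparated f → LocallyOfFiniteType f → QuasiCompact f → IsIntegral Y →
      Scheme.IsRegular Y → IsIntegral X → IsFinite g → UniversallyInjective g →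
      Function.Surjective g.base → Scheme.HasResolution X)
    (X W : Scheme.{0}) [IsIntegral X] [IsIntegral W] (f : X ⟶ Spec (.of K)) (h : W ⟶ X)
    [IsDominant h] [IsSeparated f] [LocallyOfFiniteType f] [QuasiCompact f]
    (hXn : ∀ x : X, IsIntegrallyClosed (X.presheaf.stalk x)) (hW : Scheme.IsRegular W)
    [IsFinite h] [UniversallyInjective h] : Scheme.HasResolution X := by
  obtain ⟨N, ψ, φ, hN, hφ, hψfin, hψui, hψsurj⟩ :=
    exists_frobeniusCover_of_finite_universallyInjective hp K W X f h hXn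
  haveI := hN
  haveI := hφ
  haveI := hψfin
  haveI := hψui
  -- `N ≅ X` is a finite radicial cover of the regular `W`, separated of finite type over `K`
  have hresN : Scheme.HasResolution N :=
    hPC W N (h ≫ f) ψ inferInstance inferInstance inferInstance inferInstance hW inferInstance
      inferInstance inferInstance hψsurj
  exact Scheme.HasResolution.of_iso φ hresN

/-- **PICover over a perfect field `K` implies `R1_K`** (the binder shape of the registered
residue `stub_r1Perfect` of line `Sketch`): normal degree-`p` radicial quotients of regular
varieties are resolvable. [cite: Temkin2013, Rem. 1.3.5(i)] -/
theorem r1_of_picoverOver (p : ℕ) (hp : p.Prime) (K : Type) [Field K] [CharP K p]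
    [PerfectField K]
    (hPC : ∀ (Y X : Scheme.{0}) (f : Y ⟶ Spec (.of K)) (g : X ⟶ Y),
      IsSeparated f → LocallyOfFiniteType f → QuasiCompact f → IsIntegral Y →
      Scheme.IsRegular Y → IsIntegral X → IsFinite g → UniversallyInjective g →
      Function.Surjective g.base → Scheme.HasResolution X) :
    ∀ (X W : Scheme.{0}) [IsIntegral X] [IsIntegral W] (f : X ⟶ Spec (.of K)) (h : W ⟶ X)
      [IsDominant h], IsSeparated f → LocallyOfFiniteType f → QuasiCompact f →
      (∀ x : X, IsIntegrallyClosed (X.presheaf.stalk x)) → Scheme.IsRegular W →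
      IsFinite h → UniversallyInjective h →
      Module.finrank X.functionField (FunctionFieldOver h) = p →
      Scheme.HasResolution X := by
  intro X W _ _ f h _ _ _ _ hXn hW _ _ _
  exact hasResolution_quotient_of_picoverOver p hp K hPC X W f h hXn hW

/-- **PICover over a perfect field `K` implies `ExpOneQuot_K m` for every `m`** (the
hypothesis shape of the registered glue stub `stub_core`): normal exponent-one radicial
quotients of regular varieties, of any degree, are resolvable. [cite: Temkin2013, Rem. 1.3.5(i)] -/
theorem expOneQuot_of_picoverOver (p : ℕ) (hp : p.Prime) (K : Type) [Field K] [CharP K p]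
    [PerfectField K]
    (hPC : ∀ (Y X : Scheme.{0}) (f : Y ⟶ Spec (.of K)) (g : X ⟶ Y),
      IsSeparated f → LocallyOfFiniteType f → QuasiCompact f → IsIntegral Y →
      Scheme.IsRegular Y → IsIntegral X → IsFinite g → UniversallyInjective g →
      Function.Surjective g.base → Scheme.HasResolution X) :
    ∀ (m : ℕ) (X W : Scheme.{0}) [IsIntegral X] [IsIntegral W] (f : X ⟶ Spec (.of K))
      (h : W ⟶ X) [IsDominant h], IsSeparated f → LocallyOfFiniteType f → QuasiCompact f →
      (∀ x : X, IsIntegrallyClosed (X.presheaf.stalk x)) → Scheme.IsRegular W →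
      IsFinite h → UniversallyInjective h →
      (∀ z : FunctionFieldOver h,
        z ^ p ∈ (algebraMap X.functionField (FunctionFieldOver h)).range) →
      Module.finrank X.functionField (FunctionFieldOver h) = p ^ m →
      Scheme.HasResolution X := by
  intro _ X W _ _ f h _ _ _ _ hXn hW _ _ _ _
  exact hasResolution_quotient_of_picoverOver p hp K hPC X W f h hXn hW

end Summit.ResolutionOfSingularities.ResolutionOfSingularities.Theorems.PalterationThesis.PerfectQuotient

end
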